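import Summits.NavierStokesRegularity.NavierStokesRegularity.Theorems.SoloSalvageWu2026ConstructLimitTools
import HarnessLib

/-!
# C177 `Wu2026` — sub-binder (C) of `Step_construct`: the limit equations of the Euler blow-down
# tangent — (3.51) `div(V ⊗ V) + ∇P = 0`, `div V = 0`, and the Bernoulli law (3.57) `div(QV) = 0`
# on `ℝ³ ∖ {0}` (cell `pub/ns-inputs`, seat `ns-in-wu-con`; route business of `GaldiLiouvilleGate`,
# item stmt-NavierStokesRegularity-0897)

Piece (C) of the assembly `step_construct_of_pieces` (`SoloSalvageWu2026Construct.lean`), exactly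
hypothesis `hC` there: for a Wu flow `(v, p)` with `D(v) < ∞`, any constant `c`, scales
`R_j = 2^{n_j} → ∞` and ANY pair `(V, P)` with `V_j = R_j^{2/3}v(R_j·) → V` in `L⁴_loc(ℝ³ ∖ {0})`
and `P_j = R_j^{4/3}(p − c)(R_j·) → P` in `L²_loc(ℝ³ ∖ {0})`, the limit solves the steady Euler
system weakly on `ℝ³ ∖ {0}`, is weakly divergence free, and satisfies `div(QV) = 0`,
`Q = P + |V|²/2`. Printed route (p.17 l.53 – p.19 l.76): the rescaled pair solves the steady system
with viscosity `ν_j = ν R_j^{-1/3} → 0` (3.50) (`isLerayProfile_blowDown`); test it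
(`integral_tested_momentum`, `integral_tested_divFree`, `integral_tested_bernoulli`), pass to the
limit in the nonlinear terms by the strong local convergences (3.28)/(3.45) with `q₀ = 4 > 3`
(`tendsto_lintegral_three_terms`, `tendsto_lintegral_bernV_sub_raw`), and kill the viscous terms:
`ν_j ∫ ⟪V_j, ΔΦ⟫ → 0`, `(ν_j/2) ∫ Δφ|V_j|² → 0` (bounded times `ν_j → 0`) and
`ν_j ∫ φ|∇V_j|² = ν ∫_{R_jK} |∇v|² φ(x/R_j) dx → 0` by `D(v) < ∞` (3.55)–(3.56)
(`tendsto_visc_dirichlet_blowDown`).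

Theorems only, standard axioms, no `sorry`.

WHAT THIS IS NOT: not a proof of `Step_construct` (pieces (A), (B), (E) remain); not a claim about NS
regularity or blow-up; not a claim about any author beyond the typed locator.
-/

set_option linter.dupNamespace false

noncomputable section

open MeasureTheory Set Filter Topology InnerProductSpace Metric
open scoped ENNReal NNReal Topology RealInnerProductSpace Laplacian

namespace Summit.NavierStokesRegularity.NavierStokesRegularity.Theorems.Wu2026Salvage

open Literature.Analysis.FluidPDE Literature.Analysis.FunctionSpaces Literature.Claims.NS.Wu2026

/-- **Sub-binder (C) of `Step_construct` — the limit equations (3.51), `div V = 0`, (3.57)**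
(p.18 l.1–6 «we obtain div(V ⊗ V) + ∇P = 0, div V = 0 in D′(R³ ∖ {0}) (3.51)»; p.19 l.63–76
«div(QV) = 0 in D′(R³ ∖ {0}) (3.57)»), for any `L⁴_loc × L²_loc` limit of the blow-down sequence
along scales `2^{n_j} → ∞`. This is hypothesis `hC` of `step_construct_of_pieces` verbatim.
[cite: Wu2026, (3.50)–(3.57) p.17–19] -/
theorem step_construct_pieceC :
    ∀ ν : ℝ, 0 < ν → ∀ (v : E3 → E3) (p : E3 → ℝ), IsWuFlow ν v p → dirichlet v < ∞ →
      ∀ c : ℝ, ∀ n : ℕ → ℕ, Tendsto n atTop atTop →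
      ∀ (V : E3 → E3) (P : E3 → ℝ), AEStronglyMeasurable V volume →
        AEStronglyMeasurable P volume →
        (∀ K : Set E3, IsCompact K → K ⊆ punctured →
          IntegrableOn (fun y => ‖V y‖ ^ (4 : ℝ)) K ∧
            IntegrableOn (fun y => |P y| ^ ((4 : ℝ) / 2)) K) →
        (∀ K : Set E3, IsCompact K → K ⊆ punctured →
          Tendsto (fun j => ∫ y in K, ‖blowDown ((2 : ℝ) ^ n j) v y - V y‖ ^ (4 : ℝ))
            atTop (𝓝 0)) →
        (∀ K : Set E3, IsCompact K → K ⊆ punctured →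
          Tendsto (fun j => ∫ y in K,
            |blowDownP ((2 : ℝ) ^ n j) (fun x => p x - c) y - P y| ^ ((4 : ℝ) / 2))
            atTop (𝓝 0)) →
      (∀ Φ : E3 → E3, IsTestVec punctured Φ →
          ∫ y, (⟪V y, fderiv ℝ Φ y (V y)⟫ + P y * VectorCalculus.divergence Φ y) = 0) ∧
        WeakDivFreeOn punctured V ∧
        WeakDivFreeOn punctured (fun y => bern V P y • V y) := by
  intro ν _hν v p hflow hDfin c n hn V P hVm hPm hloc hconvV hconvP
  -- the rescaled pairs and their steady systems (3.50)
  set q : E3 → ℝ := fun x => p x - c with hq_def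
  have hprofq : IsLerayProfile ν 0 v q := isLerayProfile_sub_const hflow.profile c
  have hvs : ContDiff ℝ (⊤ : ℕ∞) v := hflow.smooth_v
  have hqs : ContDiff ℝ (⊤ : ℕ∞) q := hflow.smooth_p.sub contDiff_const
  set R : ℕ → ℝ := fun j => (2 : ℝ) ^ n j with hR_def
  have hRpos : ∀ j, 0 < R j := fun j => pow_pos two_pos _
  have hRlim : Tendsto R atTop atTop := (tendsto_pow_atTop_atTop_of_one_lt one_lt_two).comp hn
  set Vj : ℕ → E3 → E3 := fun j => blowDown (R j) v with hVj_def
  set Pj : ℕ → E3 → ℝ := fun j => blowDownP (R j) q with hPj_def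
  set νj : ℕ → ℝ := fun j => ν * R j ^ (-(1 : ℝ) / 3) with hνj_def
  have hprofj : ∀ j, IsLerayProfile (νj j) 0 (Vj j) (Pj j) := fun j =>
    isLerayProfile_blowDown hprofq (hRpos j)
  have hVjs : ∀ j, ContDiff ℝ (⊤ : ℕ∞) (Vj j) := fun j => contDiff_blowDown hvs _
  have hPjs : ∀ j, ContDiff ℝ (⊤ : ℕ∞) (Pj j) := fun j => contDiff_blowDownP hqs _
  have hVjc : ∀ j, Continuous (Vj j) := fun j => (hVjs j).continuous
  have hPjc : ∀ j, Continuous (Pj j) := fun j => (hPjs j).continuous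
  have hVj1 : ∀ j, ContDiff ℝ 1 (Vj j) := fun j => (hVjs j).of_le (by norm_cast)
  have hVjm : ∀ j, AEStronglyMeasurable (Vj j) volume := fun j => (hVjc j).aestronglyMeasurable
  have hPjm : ∀ j, AEStronglyMeasurable (Pj j) volume := fun j => (hPjc j).aestronglyMeasurable
  have hνlim : Tendsto νj atTop (𝓝 0) := by
    have e : (fun j => R j ^ (-(1 : ℝ) / 3)) = (fun x : ℝ => x ^ (-((1 : ℝ) / 3))) ∘ R := by
      funext j; simp only [Function.comp_apply]; congr 1; ring
    have h1 : Tendsto (fun j => R j ^ (-(1 : ℝ) / 3)) atTop (𝓝 0) := by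
      rw [e]; exact (tendsto_rpow_neg_atTop (by norm_num : (0 : ℝ) < 1 / 3)).comp hRlim
    have := h1.const_mul ν
    rwa [mul_zero] at this
  -- the convergence data on a compact `K ⊆ ℝ³ ∖ {0}`
  have hdata : ∀ K : Set E3, IsCompact K → K ⊆ punctured →
      Tendsto (fun j => ∫⁻ y in K, ‖Vj j y - V y‖ₑ ^ (4 : ℝ)) atTop (𝓝 0) ∧
      Tendsto (fun j => ∫⁻ y in K, ‖Pj j y - P y‖ₑ ^ ((4 : ℝ) / 2)) atTop (𝓝 0) ∧
      (∫⁻ y in K, ‖V y‖ₑ ^ (4 : ℝ)) ≠ ∞ ∧ (∫⁻ y in K, ‖P y‖ₑ ^ ((4 : ℝ) / 2)) ≠ ∞ := by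
    intro K hK hKp
    refine ⟨tendsto_lintegral_V_sub_of_integral hvs.continuous hK hVm (hloc K hK hKp).1
        (hconvV K hK hKp),
      tendsto_lintegral_P_sub_of_integral hqs.continuous hK hPm (hloc K hK hKp).2 (hconvP K hK hKp),
      (lintegral_enorm_rpow_lt_top_of_integrableOn (by norm_num) (hloc K hK hKp).1).ne, ?_⟩
    have hPK : IntegrableOn (fun y => ‖P y‖ ^ ((4 : ℝ) / 2)) K volume := by
      simpa only [Real.norm_eq_abs] using (hloc K hK hKp).2
    exact (lintegral_enorm_rpow_lt_top_of_integrableOn (by norm_num) hPK).ne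
  -- measurability of `Q = P + |V|²/2` and of the `Q_j`
  have hQm : AEStronglyMeasurable (bern V P) volume := by
    have : AEMeasurable (fun y => P y + ‖V y‖ ^ 2 / 2) volume :=
      hPm.aemeasurable.add ((hVm.norm.aemeasurable.pow_const 2).div_const 2)
    exact this.aestronglyMeasurable
  have hQjc : ∀ j, Continuous (bern (Vj j) (Pj j)) := fun j => by
    show Continuous fun y => Pj j y + ‖Vj j y‖ ^ 2 / 2
    exact (hPjc j).add (((hVjc j).norm.pow 2).div_const 2)
  refine ⟨fun Φ hΦ => ?_, fun φ hφ => ?_, fun φ hφ => ?_⟩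
  ------------------------------------------------------------------
  -- (3.51): the Euler system
  ------------------------------------------------------------------
  · obtain ⟨hΦs, hΦc, hΦp⟩ := hΦ
    set K : Set E3 := tsupport Φ with hK_def
    have hK : IsCompact K := hΦc
    obtain ⟨hdlim, helim, hV4, _hP2⟩ := hdata K hK hΦp
    have hKfin : volume K ≠ ∞ := hK.measure_lt_top.ne
    have hdm : ∀ j, AEMeasurable (fun y => ‖Vj j y - V y‖ₑ) (volume.restrict K) := fun j =>
      ((hVjm j).sub hVm).enorm.restrict
    have hem : ∀ j, AEMeasurable (fun y => ‖Pj j y - P y‖ₑ) (volume.restrict K) := fun j =>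
      ((hPjm j).sub hPm).enorm.restrict
    have hWm : AEMeasurable (fun y => ‖V y‖ₑ) (volume.restrict K) := hVm.enorm.restrict
    have hΦ2 : ContDiff ℝ 2 Φ := hΦs.of_le (by norm_cast)
    have hΦ1 : ContDiff ℝ 1 Φ := hΦs.of_le (by norm_cast)
    have hDΦcont : Continuous (fderiv ℝ Φ) := hΦ1.continuous_fderiv one_ne_zero
    have hDΦc : HasCompactSupport (fderiv ℝ Φ) := hΦc.fderiv (𝕜 := ℝ)
    have hdivcont : Continuous (VectorCalculus.divergence Φ) := continuous_divergence hDΦcont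
    have hdivc : HasCompactSupport (VectorCalculus.divergence Φ) :=
      HasCompactSupport.intro hΦc fun x hx => divergence_eq_zero_of_notMem_tsupport hx
    have hΔc : HasCompactSupport (Δ Φ) :=
      HasCompactSupport.intro hΦc fun x hx => laplacian_eq_zero_of_notMem_tsupport hx
    have hΔcont : Continuous (Δ Φ) := continuous_laplacian hΦ2
    obtain ⟨MD, hMD⟩ := hDΦcont.bounded_above_of_compact_support hDΦc
    obtain ⟨Mdiv, hMdiv⟩ := hdivcont.bounded_above_of_compact_support hdivc
    obtain ⟨MΔ, hMΔ⟩ := hΔcont.bounded_above_of_compact_support hΔc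
    -- the tested momentum equation at level `j`
    have hj : ∀ j, ∫ y, (⟪Vj j y, fderiv ℝ Φ y (Vj j y)⟫ + Pj j y * VectorCalculus.divergence Φ y) =
        -(νj j * ∫ y, ⟪Vj j y, (Δ Φ) y⟫) := fun j => integral_tested_momentum (hprofj j) hΦ2 hΦc
    -- (i) the left-hand sides converge
    have hF : Tendsto (fun j => ∫ y, (⟪Vj j y, fderiv ℝ Φ y (Vj j y)⟫ +
        Pj j y * VectorCalculus.divergence Φ y)) atTop
        (𝓝 (∫ y, (⟪V y, fderiv ℝ Φ y (V y)⟫ + P y * VectorCalculus.divergence Φ y))) := by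
      have hG : Continuous fun z : E3 × (E3 × ℝ) =>
          ⟪z.2.1, fderiv ℝ Φ z.1 z.2.1⟫ + z.2.2 * VectorCalculus.divergence Φ z.1 := by
        have h1 : Continuous fun z : E3 × (E3 × ℝ) => fderiv ℝ Φ z.1 z.2.1 :=
          (hDΦcont.comp continuous_fst).clm_apply (continuous_fst.comp continuous_snd)
        exact ((continuous_fst.comp continuous_snd).inner h1).add
          ((continuous_snd.comp continuous_snd).mul (hdivcont.comp continuous_fst))
      have hmeas' : AEStronglyMeasurable ((fun z : E3 × (E3 × ℝ) =>
          ⟪z.2.1, fderiv ℝ Φ z.1 z.2.1⟫ + z.2.2 * VectorCalculus.divergence Φ z.1) ∘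
            (fun y => (y, (V y, P y)))) volume :=
        hG.comp_aestronglyMeasurable (measurable_id.aestronglyMeasurable.prodMk (hVm.prodMk hPm))
      have hfun : (fun y => ⟪V y, fderiv ℝ Φ y (V y)⟫ + P y * VectorCalculus.divergence Φ y) =
          ((fun z : E3 × (E3 × ℝ) =>
            ⟪z.2.1, fderiv ℝ Φ z.1 z.2.1⟫ + z.2.2 * VectorCalculus.divergence Φ z.1) ∘
            (fun y => (y, (V y, P y)))) := rfl
      have hmeas : AEStronglyMeasurable
          (fun y => ⟪V y, fderiv ℝ Φ y (V y)⟫ + P y * VectorCalculus.divergence Φ y) volume := by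
        rw [hfun]; exact hmeas'
      have hFi : ∀ j, Integrable (fun y => ⟪Vj j y, fderiv ℝ Φ y (Vj j y)⟫ +
          Pj j y * VectorCalculus.divergence Φ y) volume := by
        intro j
        refine Integrable.add ?_ ?_
        · refine ((hVjc j).inner (hDΦcont.clm_apply (hVjc j))).integrable_of_hasCompactSupport
            (hDΦc.mono fun x hx => ?_)
          contrapose! hx
          simp only [Function.mem_support, ne_eq, not_not] at hx ⊢
          simp [hx]
        · exact ((hPjc j).mul hdivcont).integrable_of_hasCompactSupport hdivc.mul_left
      refine tendsto_integral_of_L1 _ hmeas (Eventually.of_forall hFi) ?_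
      refine tendsto_lintegral_sub_of_support (K := K)
        (G := fun j y => ENNReal.ofReal Mdiv * ‖Pj j y - P y‖ₑ +
          ENNReal.ofReal (2 * MD) * (‖Vj j y - V y‖ₑ ^ (2 : ℝ) + ‖V y‖ₑ * ‖Vj j y - V y‖ₑ))
        (fun j y hy => ?_) (fun j y => ?_) ?_
      · rw [fderiv_of_notMem_tsupport ℝ hy, divergence_eq_zero_of_notMem_tsupport hy]
        simp
      · calc ‖(⟪Vj j y, fderiv ℝ Φ y (Vj j y)⟫ + Pj j y * VectorCalculus.divergence Φ y) -
              (⟪V y, fderiv ℝ Φ y (V y)⟫ + P y * VectorCalculus.divergence Φ y)‖ₑ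
            = ‖(Pj j y * VectorCalculus.divergence Φ y - P y * VectorCalculus.divergence Φ y) +
                (⟪Vj j y, fderiv ℝ Φ y (Vj j y)⟫ - ⟪V y, fderiv ℝ Φ y (V y)⟫)‖ₑ := by
              congr 1; ring
          _ ≤ ‖Pj j y * VectorCalculus.divergence Φ y - P y * VectorCalculus.divergence Φ y‖ₑ +
                ‖⟪Vj j y, fderiv ℝ Φ y (Vj j y)⟫ - ⟪V y, fderiv ℝ Φ y (V y)⟫‖ₑ := enorm_add_le _ _
          _ ≤ _ := add_le_add (enorm_mul_sub_mul_le ((Real.norm_eq_abs _).symm.le.trans (hMdiv y)) _ _)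
                (enorm_inner_clm_sub_le (hMD y) _ _)
      · exact tendsto_lintegral_three_terms hKfin hdm hem hWm hV4 hdlim helim
          ENNReal.ofReal_ne_top ENNReal.ofReal_ne_top
    -- (ii) the right-hand sides tend to zero
    have hlin : Tendsto (fun j => ∫ y, ⟪Vj j y, (Δ Φ) y⟫) atTop (𝓝 (∫ y, ⟪V y, (Δ Φ) y⟫)) := by
      refine tendsto_integral_of_L1 _ (hVm.inner hΔcont.aestronglyMeasurable)
        (Eventually.of_forall fun j =>
          integrable_inner_of_hasCompactSupport_right (hVjc j) hΔcont hΔc) ?_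
      refine tendsto_lintegral_sub_of_support (K := K)
        (G := fun j y => ENNReal.ofReal MΔ * ‖Vj j y - V y‖ₑ) (fun j y hy => ?_)
        (fun j y => enorm_inner_sub_inner_le (hMΔ y) _ _) ?_
      · rw [laplacian_eq_zero_of_notMem_tsupport hy]; simp
      · have h := tendsto_lintegral_one_of_four hKfin hdm hdlim
        have := ENNReal.Tendsto.const_mul (a := ENNReal.ofReal MΔ) h (Or.inr ENNReal.ofReal_ne_top)
        rw [mul_zero] at this
        refine (tendsto_congr fun j => ?_).2 this
        exact lintegral_const_mul'' _ (hdm j)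
    have hRHS : Tendsto (fun j => -(νj j * ∫ y, ⟪Vj j y, (Δ Φ) y⟫)) atTop (𝓝 0) := by
      have := (hνlim.mul hlin).neg
      rw [zero_mul, neg_zero] at this
      exact this
    -- conclusion
    have hF' : Tendsto (fun j => ∫ y, (⟪Vj j y, fderiv ℝ Φ y (Vj j y)⟫ +
        Pj j y * VectorCalculus.divergence Φ y)) atTop (𝓝 0) := by
      simp only [hj]; exact hRHS
    exact tendsto_nhds_unique hF hF'
  ------------------------------------------------------------------
  -- `div V = 0`
  ------------------------------------------------------------------
  · obtain ⟨hφs, hφc, hφp⟩ := hφ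
    set K : Set E3 := tsupport φ with hK_def
    have hK : IsCompact K := hφc
    obtain ⟨hdlim, _helim, _hV4, _hP2⟩ := hdata K hK hφp
    have hKfin : volume K ≠ ∞ := hK.measure_lt_top.ne
    have hdm : ∀ j, AEMeasurable (fun y => ‖Vj j y - V y‖ₑ) (volume.restrict K) := fun j =>
      ((hVjm j).sub hVm).enorm.restrict
    have hφ1 : ContDiff ℝ 1 φ := hφs.of_le (by norm_cast)
    have hgradcont : Continuous (gradient φ) := continuous_gradient_of_contDiff hφ1
    have hgradc : HasCompactSupport (gradient φ) :=
      HasCompactSupport.intro hφc fun x hx => gradient_eq_zero_of_notMem_tsupport hx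
    obtain ⟨Mg, hMg⟩ := hgradcont.bounded_above_of_compact_support hgradc
    have hj : ∀ j, ∫ y, ⟪Vj j y, gradient φ y⟫ = 0 := fun j =>
      integral_tested_divFree (hVj1 j) (hprofj j).divFree hφ1 hφc
    have hF : Tendsto (fun j => ∫ y, ⟪Vj j y, gradient φ y⟫) atTop
        (𝓝 (∫ y, ⟪V y, gradient φ y⟫)) := by
      refine tendsto_integral_of_L1 _ (hVm.inner hgradcont.aestronglyMeasurable)
        (Eventually.of_forall fun j =>
          integrable_inner_of_hasCompactSupport_right (hVjc j) hgradcont hgradc) ?_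
      refine tendsto_lintegral_sub_of_support (K := K)
        (G := fun j y => ENNReal.ofReal Mg * ‖Vj j y - V y‖ₑ) (fun j y hy => ?_)
        (fun j y => enorm_inner_sub_inner_le (hMg y) _ _) ?_
      · rw [gradient_eq_zero_of_notMem_tsupport hy]; simp
      · have h := tendsto_lintegral_one_of_four hKfin hdm hdlim
        have := ENNReal.Tendsto.const_mul (a := ENNReal.ofReal Mg) h (Or.inr ENNReal.ofReal_ne_top)
        rw [mul_zero] at this
        refine (tendsto_congr fun j => ?_).2 this
        exact lintegral_const_mul'' _ (hdm j)
    have hF' : Tendsto (fun j => ∫ y, ⟪Vj j y, gradient φ y⟫) atTop (𝓝 0) := by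
      simp only [hj]; exact tendsto_const_nhds
    exact tendsto_nhds_unique hF hF'
  ------------------------------------------------------------------
  -- (3.57): `div(QV) = 0`
  ------------------------------------------------------------------
  · obtain ⟨hφs, hφc, hφp⟩ := hφ
    set K : Set E3 := tsupport φ with hK_def
    have hK : IsCompact K := hφc
    obtain ⟨hdlim, helim, hV4, hP2⟩ := hdata K hK hφp
    have hKfin : volume K ≠ ∞ := hK.measure_lt_top.ne
    have hdm : ∀ j, AEMeasurable (fun y => ‖Vj j y - V y‖ₑ) (volume.restrict K) := fun j =>
      ((hVjm j).sub hVm).enorm.restrict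
    have hem : ∀ j, AEMeasurable (fun y => ‖Pj j y - P y‖ₑ) (volume.restrict K) := fun j =>
      ((hPjm j).sub hPm).enorm.restrict
    have hWm : AEMeasurable (fun y => ‖V y‖ₑ) (volume.restrict K) := hVm.enorm.restrict
    have hφ2 : ContDiff ℝ 2 φ := hφs.of_le (by norm_cast)
    have hφ1 : ContDiff ℝ 1 φ := hφs.of_le (by norm_cast)
    have hgradcont : Continuous (gradient φ) := continuous_gradient_of_contDiff hφ1
    have hgradc : HasCompactSupport (gradient φ) :=
      HasCompactSupport.intro hφc fun x hx => gradient_eq_zero_of_notMem_tsupport hx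
    have hΔc : HasCompactSupport (Δ φ) :=
      HasCompactSupport.intro hφc fun x hx => laplacian_eq_zero_of_notMem_tsupport hx
    have hΔcont : Continuous (Δ φ) := continuous_laplacian hφ2
    obtain ⟨Mg, hMg⟩ := hgradcont.bounded_above_of_compact_support hgradc
    obtain ⟨MΔ, hMΔ⟩ := hΔcont.bounded_above_of_compact_support hΔc
    -- the tested Bernoulli identity at level `j`
    have hj : ∀ j, ∫ y, ⟪bern (Vj j) (Pj j) y • Vj j y, gradient φ y⟫ =
        νj j * (∫ y, φ y * frobeniusNormSq (fderiv ℝ (Vj j) y)) -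
          (νj j / 2) * ∫ y, (Δ φ) y * ‖Vj j y‖ ^ 2 := fun j =>
      integral_tested_bernoulli (hprofj j) (hVjs j) hφ2 hφc
    -- (i) the left-hand sides converge
    have hF : Tendsto (fun j => ∫ y, ⟪bern (Vj j) (Pj j) y • Vj j y, gradient φ y⟫) atTop
        (𝓝 (∫ y, ⟪bern V P y • V y, gradient φ y⟫)) := by
      refine tendsto_integral_of_L1 _ ((hQm.smul hVm).inner hgradcont.aestronglyMeasurable)
        (Eventually.of_forall fun j => integrable_inner_of_hasCompactSupport_right
          ((hQjc j).smul (hVjc j)) hgradcont hgradc) ?_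
      refine tendsto_lintegral_sub_of_support (K := K)
        (G := fun j y => ENNReal.ofReal Mg * ‖bern (Vj j) (Pj j) y • Vj j y - bern V P y • V y‖ₑ)
        (fun j y hy => ?_) (fun j y => enorm_inner_sub_inner_le (hMg y) _ _) ?_
      · rw [gradient_eq_zero_of_notMem_tsupport hy]; simp
      · have h := tendsto_lintegral_bernV_sub_raw (K := K) hKfin hVjm hPjm hVm hPm hV4 hP2 hdlim
          helim
        have hm : ∀ j, AEMeasurable
            (fun y => ‖bern (Vj j) (Pj j) y • Vj j y - bern V P y • V y‖ₑ) (volume.restrict K) :=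
          fun j => ((((hQjc j).smul (hVjc j)).aestronglyMeasurable.sub (hQm.smul hVm)).enorm.restrict)
        have := ENNReal.Tendsto.const_mul (a := ENNReal.ofReal Mg) h (Or.inr ENNReal.ofReal_ne_top)
        rw [mul_zero] at this
        refine (tendsto_congr fun j => ?_).2 this
        exact lintegral_const_mul'' _ (hm j)
    -- (ii) the viscous terms vanish
    have hvisc : Tendsto (fun j => νj j * ∫ y, φ y * frobeniusNormSq (fderiv ℝ (Vj j) y)) atTop
        (𝓝 0) :=
      tendsto_visc_dirichlet_blowDown hvs hDfin ν hφs.continuous hφc hφp hRpos hRlim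
    have hsq : Tendsto (fun j => ∫ y, (Δ φ) y * ‖Vj j y‖ ^ 2) atTop
        (𝓝 (∫ y, (Δ φ) y * ‖V y‖ ^ 2)) := by
      have hmeas : AEStronglyMeasurable (fun y => (Δ φ) y * ‖V y‖ ^ 2) volume := by
        have : AEMeasurable (fun y => (Δ φ) y * ‖V y‖ ^ 2) volume :=
          hΔcont.aemeasurable.mul (hVm.norm.aemeasurable.pow_const 2)
        exact this.aestronglyMeasurable
      refine tendsto_integral_of_L1 _ hmeas (Eventually.of_forall fun j =>
        (hΔcont.mul ((hVjc j).norm.pow 2)).integrable_of_hasCompactSupport hΔc.mul_right) ?_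
      refine tendsto_lintegral_sub_of_support (K := K)
        (G := fun j y => ENNReal.ofReal (2 * MΔ) *
          (‖Vj j y - V y‖ₑ ^ (2 : ℝ) + ‖V y‖ₑ * ‖Vj j y - V y‖ₑ))
        (fun j y hy => ?_) (fun j y => enorm_mul_norm_sq_sub_le
          ((Real.norm_eq_abs _).symm.le.trans (hMΔ y)) _ _) ?_
      · rw [laplacian_eq_zero_of_notMem_tsupport hy]; simp
      · have h := tendsto_lintegral_three_terms hKfin hdm hem hWm hV4 hdlim helim
          (A := 0) (B := ENNReal.ofReal (2 * MΔ)) ENNReal.zero_ne_top ENNReal.ofReal_ne_top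
        simpa only [zero_mul, zero_add] using h
    have hRHS : Tendsto (fun j => νj j * (∫ y, φ y * frobeniusNormSq (fderiv ℝ (Vj j) y)) -
        (νj j / 2) * ∫ y, (Δ φ) y * ‖Vj j y‖ ^ 2) atTop (𝓝 0) := by
      have h2 : Tendsto (fun j => (νj j / 2) * ∫ y, (Δ φ) y * ‖Vj j y‖ ^ 2) atTop (𝓝 0) := by
        have := (hνlim.div_const 2).mul hsq
        rw [zero_div, zero_mul] at this
        exact this
      have := hvisc.sub h2
      rw [sub_zero] at this
      exact this
    have hF' : Tendsto (fun j => ∫ y, ⟪bern (Vj j) (Pj j) y • Vj j y, gradient φ y⟫) atTop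
        (𝓝 0) := by
      simp only [hj]; exact hRHS
    exact tendsto_nhds_unique hF hF'

end Summit.NavierStokesRegularity.NavierStokesRegularity.Theorems.Wu2026Salvage

end

-- WHAT THIS IS NOT: not a claim about NS regularity or blow-up; not a claim about any author beyond the typed locator.
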